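import Literature.Geometry.Lorentzian.IdealPoints

/-!
# Route CurvatureOrSymmetry — towards the support item `MinimalSingularTip`
(`stmt-FinalStateConjecture-10223`): minimal TIPs from lower bounds of decreasing sequences

The informal support item `MinimalSingularTip` (card K4 of
`censorship-fails-only-by-curvature-or-symmetry`; route file rev 1, lines 401–408, no Lean
signature yet) asks, inside a maximal vacuum Cauchy development with incomplete `𝓘⁺` and a visible
p.p.-singular ray, for a **⊂-minimal** singular terminal indecomposable past set (TIP): a first
visible singular ideal point with regular causal past, the Step-1 object of the tangent-profile
programme (`LorentzianMetric.IsMinimalTIP`, `IdealPoints.lean`). The card names the obstruction: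
"minimality needs a well-order/compactness on visible singular TIPs (Zorn on TIPs ordered by
inclusion works only if chains have lower bounds …); a cascade of ever-earlier, ever-weaker
concentrations converging to `p`".

This file proves the order-theoretic and point-set half of that step, for the TIPs of any
time-oriented Lorentzian manifold, so that whoever types and proves the item only owes the
geometric input (a TIP below every member of a DECREASING SEQUENCE of TIPs):

* `exists_isMinimalTIP_subset_of_chain` — Zorn form: if every nonempty `⊆`-chain of TIPs inside
  the TIP `W₀` has a TIP below it, `W₀` contains a minimal TIP.
* `exists_countable_coinitial_of_isChain_of_isOpen` — in a second-countable space a nonempty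
  `⊆`-chain of OPEN sets has a countable nonempty coinitial subfamily (a chain of open sets without
  least element is detected by basic open sets: for `s' ⊊ s` in the chain pick a basic `b ⊆ s`,
  `b ⊄ s'`, and a member `t_b ⊉ b`; the `t_b` are coinitial).
* `exists_seq_coinitial_of_isChain` — a countable coinitial subfamily of a chain yields an
  antitone coinitial sequence of members.
* `exists_isMinimalTIP_subset_of_seq` — hence (TIPs being open on a manifold without boundary,
  `IsTIP.isOpen`) on a second-countable space-time: **if below every antitone sequence of TIPs
  inside `W₀` there is a TIP, then `W₀` contains a minimal TIP** — the cascade of the card is the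
  only obstruction. `cauchyDevelopment_exists_isMinimalTIP_subset_of_seq` is the instance for the
  Cauchy developments of the route.

Pure order theory / point-set topology over the definitions of `IdealPoints.lean`
(Hawking–Ellis 1973, §6.8); no causal geometry is used and nothing here bears on the truth of the
item.
-/

-- every `Summit.FinalStateConjecture.FinalStateConjecture.…` name repeats the summit = sub-problem
-- segment (D-0017 layout); the duplicate is deliberate.
set_option linter.dupNamespace false

namespace Summit.FinalStateConjecture.FinalStateConjecture.Theorems

open Set
open scoped Manifold ContDiff Topology
open Literature.Geometry.Lorentzian

section Chains

variable {α : Type*}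

/-- **Chains of open sets in a second-countable space have countable coinitial subfamilies.**
If `c` is a nonempty `⊆`-chain of open subsets of a second-countable space, there is a countable
nonempty `T ⊆ c` such that every member of `c` contains a member of `T`. (If `c` has a least
element take it; otherwise, for every basic open `b` not contained in all members choose a member
`t_b ⊉ b`: given `s ∈ c` and `s' ⊊ s` in `c`, a basic `b ⊆ s` with `b ⊄ s'` has `t_b ⊆ s`, for
`s ⊆ t_b` would force `b ⊆ t_b`.) -/
theorem exists_countable_coinitial_of_isChain_of_isOpen [TopologicalSpace α]
    [SecondCountableTopology α] {c : Set (Set α)} (hc : IsChain (· ⊆ ·) c) (hne : c.Nonempty)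
    (hopen : ∀ s ∈ c, IsOpen s) :
    ∃ T ⊆ c, T.Countable ∧ T.Nonempty ∧ ∀ s ∈ c, ∃ t ∈ T, t ⊆ s := by
  classical
  by_cases hleast : ∃ s₀ ∈ c, ∀ s ∈ c, s₀ ⊆ s
  · obtain ⟨s₀, hs₀, hmin⟩ := hleast
    exact ⟨{s₀}, singleton_subset_iff.2 hs₀, countable_singleton _, singleton_nonempty _,
      fun s hs ↦ ⟨s₀, rfl, hmin s hs⟩⟩
  · push Not at hleast
    obtain ⟨B, hBc, -, hB⟩ := TopologicalSpace.exists_countable_basis α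
    have key : ∀ b : Set α, (∃ s ∈ c, ¬ b ⊆ s) → ∃ t ∈ c, ¬ b ⊆ t := fun b h ↦ h
    choose! t ht hbt using key
    -- for `s ∈ c` (not least) a basic open set inside `s` escaping some smaller member
    have escape : ∀ s ∈ c, ∃ b ∈ B, b ⊆ s ∧ ∃ s' ∈ c, ¬ b ⊆ s' := by
      intro s hs
      obtain ⟨s', hs', hss'⟩ := hleast s hs
      obtain ⟨x, hxs, hxs'⟩ := not_subset.1 hss'
      obtain ⟨b, hbB, hxb, hbs⟩ := hB.exists_subset_of_mem_open hxs (hopen s hs)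
      exact ⟨b, hbB, hbs, s', hs', fun h ↦ hxs' (h hxb)⟩
    refine ⟨t '' {b ∈ B | ∃ s ∈ c, ¬ b ⊆ s}, ?_, (hBc.mono (sep_subset _ _)).image _, ?_, ?_⟩
    · rintro _ ⟨b, hb, rfl⟩
      exact ht b hb.2
    · obtain ⟨s, hs⟩ := hne
      obtain ⟨b, hbB, -, hb⟩ := escape s hs
      exact ⟨t b, mem_image_of_mem _ ⟨hbB, hb⟩⟩
    · intro s hs
      obtain ⟨b, hbB, hbs, hb⟩ := escape s hs
      refine ⟨t b, mem_image_of_mem _ ⟨hbB, hb⟩, ?_⟩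
      rcases eq_or_ne (t b) s with h | h
      · exact h.le
      · rcases hc (ht b hb) hs h with h' | h'
        · exact h'
        · exact absurd (hbs.trans h') (hbt b hb)

/-- **From a countable coinitial subfamily to an antitone coinitial sequence.** If the `⊆`-chain
`c` has a countable nonempty subfamily `T` below which nothing of `c` hides (`∀ s ∈ c, ∃ t ∈ T,
t ⊆ s`), then there is an antitone sequence of members of `c` which is coinitial in `c`
(enumerate `T = {u₀, u₁, …}` and take `P₀ = u₀`, `Pₖ₊₁ = uₖ₊₁` if `uₖ₊₁ ⊆ Pₖ`, else `Pₖ`; the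
chain property gives `Pₖ ⊆ uₖ`). -/
theorem exists_seq_coinitial_of_isChain {c T : Set (Set α)} (hc : IsChain (· ⊆ ·) c)
    (hTc : T ⊆ c) (hT : T.Countable) (hTne : T.Nonempty) (hcoi : ∀ s ∈ c, ∃ t ∈ T, t ⊆ s) :
    ∃ P : ℕ → Set α, (∀ k, P k ∈ c) ∧ Antitone P ∧ ∀ s ∈ c, ∃ k, P k ⊆ s := by
  classical
  obtain ⟨u, rfl⟩ := hT.exists_eq_range hTne
  have hu : ∀ k, u k ∈ c := fun k ↦ hTc (mem_range_self k)
  obtain ⟨P, hP0, hPs⟩ : ∃ P : ℕ → Set α, P 0 = u 0 ∧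
      ∀ k, P (k + 1) = if u (k + 1) ⊆ P k then u (k + 1) else P k :=
    ⟨fun m ↦ Nat.rec (u 0) (fun k Pk ↦ if u (k + 1) ⊆ Pk then u (k + 1) else Pk) m, rfl,
      fun _ ↦ rfl⟩
  have hPc : ∀ k, P k ∈ c := by
    intro k
    induction k with
    | zero => simpa [hP0] using hu 0
    | succ k ih =>
      rw [hPs k]
      split_ifs
      · exact hu (k + 1)
      · exact ih
  have hanti : Antitone P := by
    refine antitone_nat_of_succ_le fun k ↦ ?_
    rw [hPs k]
    split_ifs with h
    · exact h
    · exact le_rfl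
  have hPu : ∀ k, P k ⊆ u k := by
    intro k
    cases k with
    | zero => exact hP0.le
    | succ k =>
      rw [hPs k]
      split_ifs with h
      · exact Subset.rfl
      · have hne : P k ≠ u (k + 1) := fun heq ↦ h (heq ▸ Subset.rfl)
        rcases hc (hPc k) (hu (k + 1)) hne with h' | h'
        · exact h'
        · exact absurd h' h
  refine ⟨P, hPc, hanti, fun s hs ↦ ?_⟩
  obtain ⟨_, ⟨k, rfl⟩, hk⟩ := hcoi s hs
  exact ⟨k, (hPu k).trans hk⟩

end Chains

section TIP

variable {E : Type*} [NormedAddCommGroup E] [NormedSpace ℝ E] {H : Type*} [TopologicalSpace H]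
  {I : ModelWithCorners ℝ E H} {n : ℕ∞ω} {M : Type*} [TopologicalSpace M] [ChartedSpace H M]
  [IsManifold I ∞ M] {g : LorentzianMetric I n M} {τ : TimeOrientation g}

/-- **Minimal TIPs, Zorn form.** Let `W₀` be a TIP of the time-oriented Lorentzian manifold
`(M, g, τ)`. If below every nonempty `⊆`-chain of TIPs contained in `W₀` there is a TIP (contained
in every member), then `W₀` contains a minimal TIP (`LorentzianMetric.IsMinimalTIP`: a TIP
containing no other TIP — a first ideal point, Hawking–Ellis 1973, §6.8, p. 219). Zorn's lemma
for `⊇` on `{W | IsTIP W ∧ W ⊆ W₀}`. -/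
theorem exists_isMinimalTIP_subset_of_chain {W₀ : Set M} (hW₀ : g.IsTIP τ W₀)
    (h : ∀ c : Set (Set M), c.Nonempty → (∀ W ∈ c, g.IsTIP τ W ∧ W ⊆ W₀) →
      IsChain (· ⊆ ·) c → ∃ W, g.IsTIP τ W ∧ ∀ s ∈ c, W ⊆ s) :
    ∃ W ⊆ W₀, g.IsMinimalTIP τ W := by
  have hlb : ∀ c ⊆ {W : Set M | g.IsTIP τ W ∧ W ⊆ W₀}, IsChain (· ⊆ ·) c → c.Nonempty →
      ∃ lb ∈ {W : Set M | g.IsTIP τ W ∧ W ⊆ W₀}, ∀ s ∈ c, lb ⊆ s := by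
    intro c hcS hc hne
    obtain ⟨W, hW, hWc⟩ := h c hne (fun W hW ↦ hcS hW) hc
    obtain ⟨s₀, hs₀⟩ := hne
    exact ⟨W, ⟨hW, (hWc s₀ hs₀).trans (hcS hs₀).2⟩, hWc⟩
  obtain ⟨m, hmW₀, hmS, hmin⟩ := zorn_superset_nonempty _ hlb W₀ ⟨hW₀, Subset.rfl⟩
  refine ⟨m, hmW₀, hmS.1, fun W' hW' hW'm ↦ ?_⟩
  exact (hmin ⟨hW', hW'm.trans hmW₀⟩ hW'm).antisymm' hW'm

/-- **Minimal TIPs from decreasing sequences.** On a second-countable time-oriented Lorentzian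
manifold without boundary (where TIPs are open, `IsTIP.isOpen`), let `W₀` be a TIP such that below
every antitone sequence `P₀ ⊇ P₁ ⊇ ⋯` of TIPs contained in `W₀` there is a TIP `W ⊆ ⋂ₖ Pₖ`. Then
`W₀` contains a minimal TIP. (Chains of open sets have countable coinitial subfamilies,
`exists_countable_coinitial_of_isChain_of_isOpen`, hence antitone coinitial sequences,
`exists_seq_coinitial_of_isChain`; conclude by `exists_isMinimalTIP_subset_of_chain`.) This is the
reduction of "a ⊂-minimal singular TIP exists" (card K4 of route `CurvatureOrSymmetry`) to the
exclusion of an infinite cascade of ever-earlier ideal points. -/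
theorem exists_isMinimalTIP_subset_of_seq [SecondCountableTopology M] [BoundarylessManifold I M]
    {W₀ : Set M} (hW₀ : g.IsTIP τ W₀)
    (h : ∀ P : ℕ → Set M, (∀ k, g.IsTIP τ (P k)) → (∀ k, P k ⊆ W₀) → Antitone P →
      ∃ W, g.IsTIP τ W ∧ ∀ k, W ⊆ P k) :
    ∃ W ⊆ W₀, g.IsMinimalTIP τ W := by
  refine exists_isMinimalTIP_subset_of_chain hW₀ fun c hne hcS hc ↦ ?_
  obtain ⟨T, hTc, hT, hTne, hcoi⟩ := exists_countable_coinitial_of_isChain_of_isOpen hc hne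
    fun s hs ↦ (hcS s hs).1.isOpen
  obtain ⟨P, hPc, hPa, hPcoi⟩ := exists_seq_coinitial_of_isChain hc hTc hT hTne hcoi
  obtain ⟨W, hW, hWP⟩ := h P (fun k ↦ (hcS _ (hPc k)).1) (fun k ↦ (hcS _ (hPc k)).2) hPa
  refine ⟨W, hW, fun s hs ↦ ?_⟩
  obtain ⟨k, hk⟩ := hPcoi s hs
  exact (hWP k).trans hk

end TIP

section Development

variable {X : Type} [TopologicalSpace X] [ChartedSpace E3 X] [IsManifold (𝓡 3) ∞ X]
  [ConnectedSpace X] {D : InitialDataSet (𝓡 3) X}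

/-- **Minimal TIPs of a Cauchy development from decreasing sequences** (the instance of
`exists_isMinimalTIP_subset_of_seq` for the (vacuum) Cauchy developments of route
`CurvatureOrSymmetry` — apply it to `𝒟.toCauchyDevelopment` — whose carriers are second-countable
`4`-manifolds without boundary): if `W₀` is a TIP of `𝒟` below every
antitone sequence of sub-TIPs of which lies a TIP, then `W₀` contains a ⊂-minimal TIP — a first
ideal point in the causal order of the completed space-time (Hawking–Ellis 1973, §6.8, p. 219). -/
theorem cauchyDevelopment_exists_isMinimalTIP_subset_of_seq
    (𝒟 : CauchyDevelopment D) {W₀ : Set 𝒟.carrier}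
    (hW₀ : 𝒟.metric.IsTIP 𝒟.timeOrientation W₀)
    (h : ∀ P : ℕ → Set 𝒟.carrier, (∀ k, 𝒟.metric.IsTIP 𝒟.timeOrientation (P k)) →
      (∀ k, P k ⊆ W₀) → Antitone P →
        ∃ W, 𝒟.metric.IsTIP 𝒟.timeOrientation W ∧ ∀ k, W ⊆ P k) :
    ∃ W ⊆ W₀, 𝒟.metric.IsMinimalTIP 𝒟.timeOrientation W :=
  exists_isMinimalTIP_subset_of_seq hW₀ h

end Development

end Summit.FinalStateConjecture.FinalStateConjecture.Theorems
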